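import Literature.Analysis.FluidPDE.KochTataruKernel
import HarnessLib

/-!
# Stub T2 of line `blowdown-kills-pitch` of crux `SymmetricLiouville`: kernel vs. Type-I weight

Crux stmt-NavierStokesRegularity-4053, route `SymmetryModuliCount`.

Pure real analysis (no PDE): the Oseen kernel majorant `k(σ, z) = (σ + ‖z‖²)^{-2}` on `ℝ³`
integrated against the temporal Type-I weight `(−τ)^{-1}` over the whole past,

  `∫_{τ<t} ∫_{ℝ³} (t − τ + ‖x − y‖²)^{-2} (−τ)^{-1} dy dτ ≤ A / √(−t)`   (`t < 0`, `x ∈ ℝ³`),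

stated in `ℝ≥0∞` (so no integrability is asserted). This is the "off-slab" source term of the
symmetry-free Oseen bootstrap of the line.

Proof.
* Space: translate `y ↦ x − y` (Lebesgue measure on `ℝ³` is an additive Haar measure) and use the
  parabolic scaling `∫_{ℝ³} (σ + ‖z‖²)^{-2} dz = c₃ σ^{-1/2}`, `c₃ = ∫ (1 + ‖w‖²)^{-2} dw ∈ (0, ∞)`
  (`lintegral_add_norm_sq_rpow_neg` with `d = 3`, `e = 2`).
* Time: after `σ = t − τ` the remaining integral is `∫_{σ>0} σ^{-1/2} (σ + (−t))^{-1} dσ`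
  (`= π/√(−t)`); we bound it by `4/√(−t)`: on `σ ≤ −t` use `(σ + (−t))^{-1} ≤ (−t)^{-1}` and
  `∫₀^{−t} σ^{-1/2} dσ = 2√(−t)`; on `σ > −t` use `(σ + (−t))^{-1} ≤ σ^{-1}` and
  `∫_{σ > −t} σ^{-3/2} dσ = 2/√(−t)`.
Hence `A = 4 c₃` works.
-/

noncomputable section

set_option linter.dupNamespace false

open Set Function Filter MeasureTheory
open scoped Topology ENNReal NNReal
open Literature.Analysis Literature.Analysis.FluidPDE

namespace Summit.NavierStokesRegularity.NavierStokesRegularity.Theorems.SymmetryModuliCountSymmetricLiouville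

/-- Local notation for physical space `ℝ³` (the registered stub signature is stated with it). -/
local notation "E3" => EuclideanSpace ℝ (Fin 3)

/-- `∫₀ᵇ σ^{-1/2} dσ = 2 √b` as a set `∫⁻` over `Ioc 0 b` (`b > 0`). -/
theorem setLIntegral_Ioc_rpow_neg_half {b : ℝ} (hb : 0 < b) :
    ∫⁻ σ in Ioc 0 b, ENNReal.ofReal (σ ^ (-(1 / 2 : ℝ))) = ENNReal.ofReal (2 * Real.sqrt b) := by
  -- adapted from Literature/Analysis/FluidPDE/KochTataruPointwise.lean
  -- (`setLIntegral_Ioo_rpow_neg_half`)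
  have hr : (-1 : ℝ) < -(1 / 2 : ℝ) := by norm_num
  have hint : IntegrableOn (fun σ : ℝ => σ ^ (-(1 / 2 : ℝ))) (Ioc 0 b) := by
    have h := (intervalIntegral.intervalIntegrable_rpow' hr (a := 0) (b := b))
    rw [intervalIntegrable_iff_integrableOn_Ioc_of_le hb.le] at h
    exact h
  rw [← ofReal_integral_eq_lintegral_ofReal hint]
  · congr 1
    rw [← intervalIntegral.integral_of_le hb.le, integral_rpow (Or.inl hr)]
    rw [Real.zero_rpow (by norm_num), Real.sqrt_eq_rpow]
    norm_num
    field_simp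
  · refine (ae_restrict_iff' measurableSet_Ioc).2 (Eventually.of_forall fun σ hσ => ?_)
    exact Real.rpow_nonneg hσ.1.le _

/-- `∫_{σ > c} σ^{-3/2} dσ = 2 c^{-1/2}` as a set `∫⁻` (`c > 0`). -/
theorem setLIntegral_Ioi_rpow_neg_three_halves {c : ℝ} (hc : 0 < c) :
    ∫⁻ σ in Ioi c, ENNReal.ofReal (σ ^ (-(3 / 2 : ℝ))) =
      ENNReal.ofReal (2 * c ^ (-(1 / 2 : ℝ))) := by
  have ha : (-(3 / 2 : ℝ)) < -1 := by norm_num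
  rw [← ofReal_integral_eq_lintegral_ofReal (integrableOn_Ioi_rpow_of_lt ha hc)]
  · congr 1
    rw [integral_Ioi_rpow_of_lt ha hc]
    rw [show (-(3 / 2 : ℝ)) + 1 = -(1 / 2 : ℝ) by norm_num]
    ring
  · refine (ae_restrict_iff' measurableSet_Ioi).2 (Eventually.of_forall fun σ hσ => ?_)
    exact Real.rpow_nonneg (hc.trans hσ).le _

/-- Translation and reflection invariance of the parabolic weight integral on `ℝ³`:
`∫ ofReal((σ + ‖x - y‖²)^{-e}) dy = ∫ ofReal((σ + ‖z‖²)^{-e}) dz`. -/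
theorem lintegral_weight_sub_left_three (σ e : ℝ) (x : E3) :
    ∫⁻ y : E3, ENNReal.ofReal ((σ + ‖x - y‖ ^ 2) ^ (-e)) =
      ∫⁻ z : E3, ENNReal.ofReal ((σ + ‖z‖ ^ 2) ^ (-e)) :=
  -- adapted from Literature/Analysis/FluidPDE/KochTataruPointwise.lean
  -- (`lintegral_weight_sub_left`)
  lintegral_sub_left_eq_self
    (fun z : E3 => ENNReal.ofReal ((σ + ‖z‖ ^ 2) ^ (-e))) x

/-- The space integral of the kernel majorant on `ℝ³`:
`∫_{ℝ³} ofReal((σ + ‖x − y‖²)⁻¹ ^ 2 · w) dy = ofReal(c₃ σ^{-1/2}) · ofReal(w)` for `σ > 0` and any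
real weight `w`, where `c₃ = ∫ (1 + ‖w‖²)^{-2} dw`. -/
theorem lintegral_kernelSq_mul_const {σ : ℝ} (hσ : 0 < σ) (w : ℝ) (x : E3) :
    ∫⁻ y : E3, ENNReal.ofReal ((σ + ‖x - y‖ ^ 2)⁻¹ ^ 2 * w) =
      ENNReal.ofReal ((∫ v : E3, (1 + ‖v‖ ^ 2) ^ (-(2 : ℝ))) *
          σ ^ (-(1 / 2 : ℝ))) * ENNReal.ofReal w := by
  have he : (Module.finrank ℝ E3 : ℝ) < 2 * 2 := by
    rw [finrank_euclideanSpace_fin]; norm_num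
  have hpt : ∀ y : E3, ENNReal.ofReal ((σ + ‖x - y‖ ^ 2)⁻¹ ^ 2 * w) =
      ENNReal.ofReal ((σ + ‖x - y‖ ^ 2) ^ (-(2 : ℝ))) * ENNReal.ofReal w := by
    intro y
    have hb : 0 < σ + ‖x - y‖ ^ 2 := add_pos_of_pos_of_nonneg hσ (sq_nonneg _)
    rw [← ENNReal.ofReal_mul (Real.rpow_nonneg hb.le _), Real.rpow_neg hb.le, Real.rpow_two,
      inv_pow]
  simp_rw [hpt]
  rw [lintegral_mul_const' _ _ ENNReal.ofReal_ne_top, lintegral_weight_sub_left_three,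
    lintegral_add_norm_sq_rpow_neg he hσ, finrank_euclideanSpace_fin]
  congr 2
  rw [mul_comm]
  congr 1
  norm_num

/-- **Stub T2 — the kernel against the temporal weight**:
`∫_{τ<t}∫_{ℝ³}(t−τ+‖x−y‖²)^{-2}(−τ)^{-1} dy dτ ≤ A/√(−t)` for all `t < 0`, `x ∈ ℝ³`, with
`A = 4 ∫_{ℝ³} (1 + ‖w‖²)^{-2} dw` (`∫_{ℝ³}(σ+‖z‖²)^{-2}dz = c₃ σ^{-1/2}`,
`∫_{τ<t}(t−τ)^{-1/2}(−τ)^{-1}dτ ≤ 4/√(−t)`). -/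
theorem stub_kernelTimeWeightIntegral :
    ∃ A : ℝ, 0 < A ∧ ∀ t < 0, ∀ x : E3,
      ∫⁻ τ in Set.Iio t, ∫⁻ y, ENNReal.ofReal ((t - τ + ‖x - y‖ ^ 2)⁻¹ ^ 2 * (-τ)⁻¹) ≤
        ENNReal.ofReal (A / Real.sqrt (-t)) := by
  set c₃ : ℝ := ∫ v : E3, (1 + ‖v‖ ^ 2) ^ (-(2 : ℝ)) with hc₃
  have he : (Module.finrank ℝ E3 : ℝ) < 2 * 2 := by
    rw [finrank_euclideanSpace_fin]; norm_num
  have hc₃0 : 0 < c₃ := integral_one_add_norm_sq_rpow_neg_pos he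
  refine ⟨4 * c₃, by positivity, fun t ht x => ?_⟩
  have ht0 : 0 < -t := neg_pos.2 ht
  have hsq0 : 0 < Real.sqrt (-t) := Real.sqrt_pos.2 ht0
  -- the one-dimensional integrand after the space integration, in the variable `σ = t - τ`
  set H : ℝ → ℝ≥0∞ := fun σ =>
    ENNReal.ofReal (c₃ * σ ^ (-(1 / 2 : ℝ))) * ENNReal.ofReal ((σ + -t)⁻¹) with hH
  -- substitution `σ = t - τ`
  have hsub : ∫⁻ τ in Iio t, H (t - τ) = ∫⁻ σ in Ioi 0, H σ := by
    have hmp : MeasurePreserving (fun s : ℝ => t - s) volume volume :=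
      Measure.measurePreserving_sub_left volume t
    have hemb : MeasurableEmbedding (fun s : ℝ => t - s) :=
      (MeasurableEquiv.subLeft t).measurableEmbedding
    have h := hmp.setLIntegral_comp_preimage_emb hemb H (Ioi 0)
    rw [preimage_const_sub_Ioi, sub_zero] at h
    exact h
  -- near piece `0 < σ ≤ -t`
  have hnear : ∫⁻ σ in Ioc 0 (-t), H σ ≤ ENNReal.ofReal (2 * c₃ / Real.sqrt (-t)) := by
    calc ∫⁻ σ in Ioc 0 (-t), H σ
        ≤ ∫⁻ σ in Ioc 0 (-t), ENNReal.ofReal c₃ * ENNReal.ofReal (σ ^ (-(1 / 2 : ℝ))) *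
            ENNReal.ofReal ((-t)⁻¹) := by
          refine setLIntegral_mono' measurableSet_Ioc fun σ hσ => ?_
          rw [hH]
          dsimp only
          rw [ENNReal.ofReal_mul hc₃0.le]
          gcongr
          linarith [hσ.1]
      _ = ENNReal.ofReal c₃ * (∫⁻ σ in Ioc 0 (-t), ENNReal.ofReal (σ ^ (-(1 / 2 : ℝ)))) *
            ENNReal.ofReal ((-t)⁻¹) := by
          rw [lintegral_mul_const' _ _ ENNReal.ofReal_ne_top,
            lintegral_const_mul' _ _ ENNReal.ofReal_ne_top]
      _ = ENNReal.ofReal (2 * c₃ / Real.sqrt (-t)) := by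
          rw [setLIntegral_Ioc_rpow_neg_half ht0, ← ENNReal.ofReal_mul hc₃0.le,
            ← ENNReal.ofReal_mul (by positivity)]
          congr 1
          calc c₃ * (2 * Real.sqrt (-t)) * (-t)⁻¹ = 2 * c₃ * (Real.sqrt (-t) / (-t)) := by ring
            _ = 2 * c₃ / Real.sqrt (-t) := by rw [Real.sqrt_div_self]; ring
  -- far piece `σ > -t`
  have hfar : ∫⁻ σ in Ioi (-t), H σ ≤ ENNReal.ofReal (2 * c₃ / Real.sqrt (-t)) := by
    calc ∫⁻ σ in Ioi (-t), H σ
        ≤ ∫⁻ σ in Ioi (-t), ENNReal.ofReal c₃ * ENNReal.ofReal (σ ^ (-(3 / 2 : ℝ))) := by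
          refine setLIntegral_mono' measurableSet_Ioi fun σ hσ => ?_
          have hσ0 : 0 < σ := ht0.trans hσ
          rw [hH]
          dsimp only
          rw [← ENNReal.ofReal_mul (by positivity), ← ENNReal.ofReal_mul hc₃0.le]
          refine ENNReal.ofReal_le_ofReal ?_
          have h1 : (σ + -t)⁻¹ ≤ σ⁻¹ := inv_anti₀ hσ0 (by linarith)
          have h2 : σ ^ (-(3 / 2 : ℝ)) = σ ^ (-(1 / 2 : ℝ)) * σ⁻¹ := by
            rw [← Real.rpow_neg_one, ← Real.rpow_add hσ0]
            norm_num
          rw [h2, mul_assoc]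
          gcongr
      _ = ENNReal.ofReal c₃ * ENNReal.ofReal (2 * (-t) ^ (-(1 / 2 : ℝ))) := by
          rw [lintegral_const_mul' _ _ ENNReal.ofReal_ne_top,
            setLIntegral_Ioi_rpow_neg_three_halves ht0]
      _ = ENNReal.ofReal (2 * c₃ / Real.sqrt (-t)) := by
          rw [← ENNReal.ofReal_mul hc₃0.le, Real.rpow_neg ht0.le, ← Real.sqrt_eq_rpow]
          congr 1
          ring
  -- assemble
  calc ∫⁻ τ in Iio t, ∫⁻ y, ENNReal.ofReal ((t - τ + ‖x - y‖ ^ 2)⁻¹ ^ 2 * (-τ)⁻¹)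
      = ∫⁻ τ in Iio t, H (t - τ) := by
        refine setLIntegral_congr_fun measurableSet_Iio fun τ hτ => ?_
        rw [lintegral_kernelSq_mul_const (sub_pos.2 hτ) ((-τ)⁻¹) x, hH]
        dsimp only
        rw [show t - τ + -t = -τ by ring]
    _ = ∫⁻ σ in Ioi 0, H σ := hsub
    _ = ∫⁻ σ in Ioc 0 (-t) ∪ Ioi (-t), H σ := by rw [Ioc_union_Ioi_eq_Ioi ht0.le]
    _ ≤ (∫⁻ σ in Ioc 0 (-t), H σ) + ∫⁻ σ in Ioi (-t), H σ := lintegral_union_le _ _ _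
    _ ≤ ENNReal.ofReal (2 * c₃ / Real.sqrt (-t)) + ENNReal.ofReal (2 * c₃ / Real.sqrt (-t)) :=
        add_le_add hnear hfar
    _ = ENNReal.ofReal (4 * c₃ / Real.sqrt (-t)) := by
        rw [← ENNReal.ofReal_add (by positivity) (by positivity)]
        congr 1
        ring

end Summit.NavierStokesRegularity.NavierStokesRegularity.Theorems.SymmetryModuliCountSymmetricLiouville
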